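import Summits.CriticalPhenomena.PercolationContinuityZ3.Theorems.Transplant.FKDoubleFanMultifanCellOneOne1
import Summits.CriticalPhenomena.PercolationContinuityZ3.Theorems.Transplant.FKDoubleFanMultifanGood
import HarnessLib

/-!
# Double fans, MULTIFAN₁ middles: the elementary cells of LEMMA‴ at the endpoint pair `(One, One)` — part 2/2

Helper file (`--supports stmt-CriticalPhenomena-4575`), FK sub-lane `prim-bschramm-fk-3` (gen 35); builds on p205010 (kernel theorem, internal audit
signed; external expert review pending).  Pure real polynomial algebra, no sorries; standard axioms.  Memo `bschramm/prim-bschramm-fk-3/FAR-CROSS-X.md` §2.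

`GoodIJ q P S` (`…MultifanGood`) at the endpoint product vectors `P = rayOne`, `S = rayOne`: the 36 pairings
`pairH q (swapYZ (gen_j S)) (gen_i P)`, `i, j ∈ {A, N, C1, C2, Dg, R(t,w)}`, each either vanishing identically or equal to an explicit positive
multiple of `q^a(1−q)^b(2−q)^c` times a product of certified factors `mfFac<n>` (`…MultifanFac*`) / of the kernel polynomials `coreStruct`,
`mfCone`, `mfCtwo`, `core4` — one `ring` identity and `positivity` per cell (exact computer algebra, work/lab36/gen_cells.py).
[folklore]
-/

noncomputable section

namespace Summit.CriticalPhenomena.PercolationContinuityZ3.Theorems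

namespace FK

namespace ThreeApex

set_option maxRecDepth 30000 in
set_option maxHeartbeats 4000000 in
/-- Cell `(R,R,One,One)` vanishes identically. [folklore] -/
theorem mfCell_R_R_One_One {q tf wf tg wg : ℝ} (_hq0 : 0 ≤ q) (_hq1 : q ≤ 1) (_htf : 0 ≤ tf) (_hwf0 : 0 ≤ wf) (_hwf1 : wf ≤ 1) (_htg : 0 ≤ tg) (_hwg0 : 0 ≤ wg) (_hwg1 : wg ≤ 1) :
    0 ≤ pairH q (Biv.swapYZ (genR q tg wg rayOne)) (genR q tf wf rayOne) := by
  have e : pairH q (Biv.swapYZ (genR q tg wg rayOne)) (genR q tf wf rayOne) = 0 := by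
    simp only [pairH, Biv.swapYZ, genR, rayOne]; ring
  exact e.symm.le

/-- **`GoodIJ` at the endpoint pair `(One, One)`**: all 36 generator pairings are `≥ 0`. [folklore] -/
theorem goodIJ_One_One {q : ℝ} (hq0 : 0 ≤ q) (hq1 : q ≤ 1) :
    GoodIJ q rayOne rayOne := by
  intro β γ hβ hγ
  rcases hβ with _ | _ | _ | _ | _ | ⟨htf, hwf0, hwf1⟩ <;> rcases hγ with _ | _ | _ | _ | _ | ⟨htg, hwg0, hwg1⟩
  · exact mfCell_A_A_One_One hq0 hq1
  · exact mfCell_A_N_One_One hq0 hq1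
  · exact mfCell_A_C1_One_One hq0 hq1
  · exact mfCell_A_C2_One_One hq0 hq1
  · exact mfCell_A_Dg_One_One hq0 hq1
  · exact mfCell_A_R_One_One hq0 hq1 htg hwg0 hwg1
  · exact mfCell_N_A_One_One hq0 hq1
  · exact mfCell_N_N_One_One hq0 hq1
  · exact mfCell_N_C1_One_One hq0 hq1
  · exact mfCell_N_C2_One_One hq0 hq1
  · exact mfCell_N_Dg_One_One hq0 hq1
  · exact mfCell_N_R_One_One hq0 hq1 htg hwg0 hwg1
  · exact mfCell_C1_A_One_One hq0 hq1
  · exact mfCell_C1_N_One_One hq0 hq1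
  · exact mfCell_C1_C1_One_One hq0 hq1
  · exact mfCell_C1_C2_One_One hq0 hq1
  · exact mfCell_C1_Dg_One_One hq0 hq1
  · exact mfCell_C1_R_One_One hq0 hq1 htg hwg0 hwg1
  · exact mfCell_C2_A_One_One hq0 hq1
  · exact mfCell_C2_N_One_One hq0 hq1
  · exact mfCell_C2_C1_One_One hq0 hq1
  · exact mfCell_C2_C2_One_One hq0 hq1
  · exact mfCell_C2_Dg_One_One hq0 hq1
  · exact mfCell_C2_R_One_One hq0 hq1 htg hwg0 hwg1
  · exact mfCell_Dg_A_One_One hq0 hq1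
  · exact mfCell_Dg_N_One_One hq0 hq1
  · exact mfCell_Dg_C1_One_One hq0 hq1
  · exact mfCell_Dg_C2_One_One hq0 hq1
  · exact mfCell_Dg_Dg_One_One hq0 hq1
  · exact mfCell_Dg_R_One_One hq0 hq1 htg hwg0 hwg1
  · exact mfCell_R_A_One_One hq0 hq1 htf hwf0 hwf1
  · exact mfCell_R_N_One_One hq0 hq1 htf hwf0 hwf1
  · exact mfCell_R_C1_One_One hq0 hq1 htf hwf0 hwf1
  · exact mfCell_R_C2_One_One hq0 hq1 htf hwf0 hwf1
  · exact mfCell_R_Dg_One_One hq0 hq1 htf hwf0 hwf1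
  · exact mfCell_R_R_One_One hq0 hq1 htf hwf0 hwf1 htg hwg0 hwg1
end ThreeApex

end FK

end Summit.CriticalPhenomena.PercolationContinuityZ3.Theorems
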